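import Literature.Analysis.OperatorTheory.DiagonalPerturbationEigenbasis
import HarnessLib

/-!
# Regularity bootstrap for eigenvectors of a diagonal operator under a banded perturbation

Topic `Literature/Analysis/OperatorTheory`; the quantitative "elliptic regularity" behind the
smoothness of perturbed classical eigenfunctions (oblate spheroidal harmonics: Dafermos–Rodnianski–
Shlapentokh-Rothman, arXiv:1402.7034, §5.2.1, "smooth eigenfunctions `S_{mℓ}`"), in the coordinates
of `DiagonalPerturbationEigenbasis.lean`. Setting: a Hilbert basis `e` (eigenbasis of the
unperturbed operator `D = diag(d)`), weights `w_i ≥ 0` (think `w_i = 1 + |d_i|`), the Sobolev-type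
scale `N_s(f) = Σ_i w_i^{2s} |⟨e_i, f⟩|²` (`sobSum`, valued in `ℝ≥0∞`), and a bounded symmetric
perturbation `B` which is **banded**: `⟨e_j, B e_i⟩ = 0` unless `j ∈ nbr i`, a symmetric
neighbour relation of width `≤ W` along which the weights are comparable (`w_i ≤ L w_j`).

* `sobSum_map_le` — **`B` is bounded on every level of the scale**:
  `N_s(B f) ≤ W² ‖B‖² L^{2s} N_s(f)` (Schur test on the band);
* `sobSum_succ_le_of_eigen` — for an eigenvector, `d_i ⟨e_i,f⟩ + ⟨e_i, B f⟩ = λ ⟨e_i, f⟩`,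
  `N_{s+1}(f) ≤ 2((1+|λ|)² + W² ‖B‖² L^{2s}) N_s(f)` when `w_i = 1 + |d_i|`;
* `sobSum_le_of_eigen` — **the bootstrap**: `N_s(f) ≤ (2((1+|λ|)² + W²‖B‖²L^{2s}))^s ‖f‖²`, in
  particular finite for every `s` (the coefficients of `f` decay faster than any power of the
  levels).

## References

* M. Reed, B. Simon, *Methods of Modern Mathematical Physics IV* (1978), §XIII.16 (regularity of
  eigenfunctions by bootstrapping the eigenvalue equation). [ReedSimonIV1978]
* M. Dafermos, I. Rodnianski, Y. Shlapentokh-Rothman, arXiv:1402.7034, §5.2.1.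
  [DafermosRodnianskiShlapentokhrothman2014]
-/

noncomputable section

open Filter Topology Set ContinuousLinearMap
open scoped InnerProductSpace ComplexConjugate ENNReal

namespace Literature.Analysis.OperatorTheory

variable {ι : Type*} {𝕜 : Type*} [RCLike 𝕜]
variable {H : Type*} [NormedAddCommGroup H] [InnerProductSpace 𝕜 H]

/-! ### The Sobolev-type scale of a Hilbert basis -/

/-- **`N_s(f) = Σ_i w_i^{2s} |⟨e_i, f⟩|²`** (in `ℝ≥0∞`). [folklore] -/
def sobSum (e : HilbertBasis ι 𝕜 H) (w : ι → ℝ) (s : ℕ) (f : H) : ℝ≥0∞ :=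
  ∑' i, ENNReal.ofReal (w i ^ (2 * s) * ‖⟪e i, f⟫_𝕜‖ ^ 2)

variable {e : HilbertBasis ι 𝕜 H} {w : ι → ℝ}

/-- `N_0(f) = ‖f‖²` (Parseval). [folklore] -/
theorem sobSum_zero (f : H) : sobSum e w 0 f = ENNReal.ofReal (‖f‖ ^ 2) := by
  have h2 : (0 : ℝ) < (2 : ℝ≥0∞).toReal := by norm_num
  have h0 := lp.hasSum_norm h2 (e.repr f)
  rw [LinearIsometryEquiv.norm_map] at h0
  simp only [ENNReal.toReal_ofNat, Real.rpow_two] at h0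
  have h : HasSum (fun i ↦ ‖⟪e i, f⟫_𝕜‖ ^ 2) (‖f‖ ^ 2) := by
    convert h0 using 1
    funext i
    rw [HilbertBasis.repr_apply_apply]
  rw [sobSum]
  simp only [mul_zero, pow_zero, one_mul]
  rw [← ENNReal.ofReal_tsum_of_nonneg (fun i ↦ by positivity) h.summable, h.tsum_eq]

/-! ### Banded operators -/

section Banded

variable {B : H →L[𝕜] H} {nbr : ι → Finset ι}

/-- **Finite expansion of `B e_i` along the band.** [folklore] -/
theorem map_basis_eq_sum (hB0 : ∀ i j, j ∉ nbr i → ⟪e j, B (e i)⟫_𝕜 = 0) (i : ι) :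
    B (e i) = ∑ j ∈ nbr i, ⟪e j, B (e i)⟫_𝕜 • e j := by
  classical
  refine e.ext_inner fun k ↦ ?_
  rw [inner_sum]
  simp_rw [inner_smul_right]
  have horth : ∀ j, ⟪e k, e j⟫_𝕜 = if k = j then 1 else 0 := fun j ↦ by
    rw [orthonormal_iff_ite.1 e.orthonormal]
  simp_rw [horth, mul_ite, mul_one, mul_zero]
  rw [Finset.sum_ite_eq]
  split_ifs with hk
  · rfl
  · exact hB0 i k hk

/-- **Coefficients of `B f` are finite sums along the band**:
`⟨e_i, B f⟩ = Σ_{j ∈ nbr i} conj⟨e_j, B e_i⟩ ⟨e_j, f⟩` (`B` symmetric). [folklore] -/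
theorem inner_basis_map_eq_sum (hB0 : ∀ i j, j ∉ nbr i → ⟪e j, B (e i)⟫_𝕜 = 0)
    (hBs : ∀ x y, ⟪B x, y⟫_𝕜 = ⟪x, B y⟫_𝕜) (f : H) (i : ι) :
    ⟪e i, B f⟫_𝕜 = ∑ j ∈ nbr i, conj ⟪e j, B (e i)⟫_𝕜 * ⟪e j, f⟫_𝕜 := by
  have hexp := map_basis_eq_sum hB0 i
  calc ⟪e i, B f⟫_𝕜 = ⟪B (e i), f⟫_𝕜 := (hBs _ _).symm
    _ = ⟪∑ j ∈ nbr i, ⟪e j, B (e i)⟫_𝕜 • e j, f⟫_𝕜 := by rw [← hexp]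
    _ = ∑ j ∈ nbr i, conj ⟪e j, B (e i)⟫_𝕜 * ⟪e j, f⟫_𝕜 := by
        rw [sum_inner]
        refine Finset.sum_congr rfl fun j _ ↦ ?_
        rw [inner_smul_left]

/-- **Row estimate**: `|⟨e_i, B f⟩|² ≤ W ‖B‖² Σ_{j ∈ nbr i} |⟨e_j, f⟩|²`. [folklore] -/
theorem norm_sq_inner_map_le (hB0 : ∀ i j, j ∉ nbr i → ⟪e j, B (e i)⟫_𝕜 = 0)
    (hBs : ∀ x y, ⟪B x, y⟫_𝕜 = ⟪x, B y⟫_𝕜) {W : ℕ} (hW : ∀ i, (nbr i).card ≤ W) (f : H) (i : ι) :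
    ‖⟪e i, B f⟫_𝕜‖ ^ 2 ≤ W * ‖B‖ ^ 2 * ∑ j ∈ nbr i, ‖⟪e j, f⟫_𝕜‖ ^ 2 := by
  rw [inner_basis_map_eq_sum hB0 hBs f i]
  have hentry : ∀ j, ‖conj ⟪e j, B (e i)⟫_𝕜‖ ≤ ‖B‖ := fun j ↦ by
    rw [RCLike.norm_conj]
    calc ‖⟪e j, B (e i)⟫_𝕜‖ ≤ ‖e j‖ * ‖B (e i)‖ := norm_inner_le_norm _ _
      _ ≤ 1 * (‖B‖ * ‖e i‖) := by
          rw [e.orthonormal.1 j]; exact mul_le_mul_of_nonneg_left (le_opNorm _ _) zero_le_one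
      _ = ‖B‖ := by rw [e.orthonormal.1 i, one_mul, mul_one]
  have h1 : ‖∑ j ∈ nbr i, conj ⟪e j, B (e i)⟫_𝕜 * ⟪e j, f⟫_𝕜‖ ≤
      ∑ j ∈ nbr i, ‖B‖ * ‖⟪e j, f⟫_𝕜‖ := by
    refine (norm_sum_le _ _).trans (Finset.sum_le_sum fun j _ ↦ ?_)
    rw [norm_mul]
    exact mul_le_mul_of_nonneg_right (hentry j) (norm_nonneg _)
  have h2 : (∑ j ∈ nbr i, ‖B‖ * ‖⟪e j, f⟫_𝕜‖) ^ 2 ≤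
      (∑ j ∈ nbr i, ‖B‖ ^ 2) * ∑ j ∈ nbr i, ‖⟪e j, f⟫_𝕜‖ ^ 2 :=
    Finset.sum_mul_sq_le_sq_mul_sq _ _ _
  have h3 : (∑ j ∈ nbr i, ‖B‖ ^ 2) ≤ W * ‖B‖ ^ 2 := by
    rw [Finset.sum_const, nsmul_eq_mul]
    exact mul_le_mul_of_nonneg_right (by exact_mod_cast hW i) (sq_nonneg _)
  calc ‖∑ j ∈ nbr i, conj ⟪e j, B (e i)⟫_𝕜 * ⟪e j, f⟫_𝕜‖ ^ 2
      ≤ (∑ j ∈ nbr i, ‖B‖ * ‖⟪e j, f⟫_𝕜‖) ^ 2 :=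
        pow_le_pow_left₀ (norm_nonneg _) h1 2
    _ ≤ (∑ j ∈ nbr i, ‖B‖ ^ 2) * ∑ j ∈ nbr i, ‖⟪e j, f⟫_𝕜‖ ^ 2 := h2
    _ ≤ W * ‖B‖ ^ 2 * ∑ j ∈ nbr i, ‖⟪e j, f⟫_𝕜‖ ^ 2 :=
        mul_le_mul_of_nonneg_right h3 (Finset.sum_nonneg fun _ _ ↦ sq_nonneg _)

/-- Double counting along a symmetric neighbour relation of width `≤ W`:
`Σ_i Σ_{j ∈ nbr i} g_j ≤ W Σ_j g_j`. [folklore] -/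
theorem tsum_sum_nbr_le (hsymm : ∀ i j, j ∈ nbr i ↔ i ∈ nbr j) {W : ℕ} (hW : ∀ i, (nbr i).card ≤ W)
    (g : ι → ℝ≥0∞) : ∑' i, ∑ j ∈ nbr i, g j ≤ W * ∑' j, g j := by
  classical
  have h1 : ∀ i, ∑ j ∈ nbr i, g j = ∑' j, if j ∈ nbr i then g j else 0 := fun i ↦ by
    rw [tsum_eq_sum (s := nbr i) (fun j hj ↦ if_neg hj)]
    exact Finset.sum_congr rfl fun j hj ↦ (if_pos hj).symm
  simp_rw [h1]
  rw [ENNReal.tsum_comm, ← ENNReal.tsum_mul_left]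
  refine ENNReal.tsum_le_tsum fun j ↦ ?_
  have h2 : ∑' i, (if j ∈ nbr i then g j else 0) = ∑ i ∈ nbr j, g j := by
    rw [tsum_eq_sum (s := nbr j) (fun i hi ↦ ?_)]
    · exact Finset.sum_congr rfl fun i hi ↦ if_pos ((hsymm j i).1 hi)
    · rw [if_neg (fun h ↦ hi ((hsymm i j).1 h))]
  rw [h2, Finset.sum_const, nsmul_eq_mul]
  exact mul_le_mul_of_nonneg_right (by exact_mod_cast hW j) (by positivity)

/-- **Schur test on the band**: `N_s(B f) ≤ W² ‖B‖² L^{2s} N_s(f)` when the weights are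
comparable along the band (`w_i ≤ L w_j` for `j ∈ nbr i`, `w ≥ 0`).
[cite: ReedSimonIV1978, §XIII.16] -/
theorem sobSum_map_le (hB0 : ∀ i j, j ∉ nbr i → ⟪e j, B (e i)⟫_𝕜 = 0)
    (hBs : ∀ x y, ⟪B x, y⟫_𝕜 = ⟪x, B y⟫_𝕜) (hsymm : ∀ i j, j ∈ nbr i ↔ i ∈ nbr j) {W : ℕ}
    (hW : ∀ i, (nbr i).card ≤ W) (hw : ∀ i, 0 ≤ w i) {L : ℝ} (hLnn : 0 ≤ L)
    (hL : ∀ i j, j ∈ nbr i → w i ≤ L * w j) (s : ℕ) (f : H) :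
    sobSum e w s (B f) ≤ ENNReal.ofReal (W ^ 2 * ‖B‖ ^ 2 * L ^ (2 * s)) * sobSum e w s f := by
  have hL0 : ∀ i j, j ∈ nbr i → 0 ≤ L * w j := fun i j hj ↦ (hw i).trans (hL i j hj)
  -- termwise: `w_i^{2s} |⟨e_i, Bf⟩|² ≤ W ‖B‖² L^{2s} Σ_{j∈nbr i} w_j^{2s} |⟨e_j, f⟩|²`
  have hterm : ∀ i, ENNReal.ofReal (w i ^ (2 * s) * ‖⟪e i, B f⟫_𝕜‖ ^ 2) ≤
      ENNReal.ofReal (W * ‖B‖ ^ 2 * L ^ (2 * s)) *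
        ∑ j ∈ nbr i, ENNReal.ofReal (w j ^ (2 * s) * ‖⟪e j, f⟫_𝕜‖ ^ 2) := by
    intro i
    rw [← ENNReal.ofReal_sum_of_nonneg (fun j _ ↦ mul_nonneg (pow_nonneg (hw j) _) (sq_nonneg _)),
      ← ENNReal.ofReal_mul (by positivity)]
    refine ENNReal.ofReal_le_ofReal ?_
    have h1 := norm_sq_inner_map_le hB0 hBs hW f i
    have h2 : ∀ j ∈ nbr i, w i ^ (2 * s) * ‖⟪e j, f⟫_𝕜‖ ^ 2 ≤
        L ^ (2 * s) * (w j ^ (2 * s) * ‖⟪e j, f⟫_𝕜‖ ^ 2) := fun j hj ↦ by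
      rw [← mul_assoc, ← mul_pow]
      exact mul_le_mul_of_nonneg_right (pow_le_pow_left₀ (hw i) (hL i j hj) _) (sq_nonneg _)
    calc w i ^ (2 * s) * ‖⟪e i, B f⟫_𝕜‖ ^ 2
        ≤ w i ^ (2 * s) * (W * ‖B‖ ^ 2 * ∑ j ∈ nbr i, ‖⟪e j, f⟫_𝕜‖ ^ 2) :=
          mul_le_mul_of_nonneg_left h1 (pow_nonneg (hw i) _)
      _ = W * ‖B‖ ^ 2 * ∑ j ∈ nbr i, w i ^ (2 * s) * ‖⟪e j, f⟫_𝕜‖ ^ 2 := by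
          rw [Finset.mul_sum, Finset.mul_sum, Finset.mul_sum]
          refine Finset.sum_congr rfl fun j _ ↦ by ring
      _ ≤ W * ‖B‖ ^ 2 * ∑ j ∈ nbr i, L ^ (2 * s) * (w j ^ (2 * s) * ‖⟪e j, f⟫_𝕜‖ ^ 2) :=
          mul_le_mul_of_nonneg_left (Finset.sum_le_sum h2) (by positivity)
      _ = W * ‖B‖ ^ 2 * L ^ (2 * s) * ∑ j ∈ nbr i, w j ^ (2 * s) * ‖⟪e j, f⟫_𝕜‖ ^ 2 := by
          rw [← Finset.mul_sum]; ring
  calc sobSum e w s (B f) ≤ ∑' i, ENNReal.ofReal (W * ‖B‖ ^ 2 * L ^ (2 * s)) *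
        ∑ j ∈ nbr i, ENNReal.ofReal (w j ^ (2 * s) * ‖⟪e j, f⟫_𝕜‖ ^ 2) :=
        ENNReal.tsum_le_tsum hterm
    _ = ENNReal.ofReal (W * ‖B‖ ^ 2 * L ^ (2 * s)) *
        ∑' i, ∑ j ∈ nbr i, ENNReal.ofReal (w j ^ (2 * s) * ‖⟪e j, f⟫_𝕜‖ ^ 2) :=
        ENNReal.tsum_mul_left
    _ ≤ ENNReal.ofReal (W * ‖B‖ ^ 2 * L ^ (2 * s)) * (W * sobSum e w s f) :=
        mul_le_mul' le_rfl (tsum_sum_nbr_le hsymm hW _)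
    _ = ENNReal.ofReal (W ^ 2 * ‖B‖ ^ 2 * L ^ (2 * s)) * sobSum e w s f := by
        rw [← mul_assoc, ← ENNReal.ofReal_natCast, ← ENNReal.ofReal_mul (by positivity)]
        congr 2
        ring

/-! ### The bootstrap for eigenvectors -/

/-- **One step**: for `w_i = 1 + |d_i|` and an eigenvector `f`
(`d_i ⟨e_i, f⟩ + ⟨e_i, B f⟩ = λ ⟨e_i, f⟩` for all `i`),
`N_{s+1}(f) ≤ 2 (1+|λ|)² N_s(f) + 2 N_s(B f)`. [cite: ReedSimonIV1978, §XIII.16] -/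
theorem sobSum_succ_le_of_eigen_aux {d : ι → ℝ} (hw : ∀ i, w i = 1 + |d i|) {f : H} {lam : ℝ}
    (heig : ∀ i, (d i : 𝕜) * ⟪e i, f⟫_𝕜 + ⟪e i, B f⟫_𝕜 = (lam : 𝕜) * ⟪e i, f⟫_𝕜) (s : ℕ) :
    sobSum e w (s + 1) f ≤
      ENNReal.ofReal (2 * (1 + |lam|) ^ 2) * sobSum e w s f + 2 * sobSum e w s (B f) := by
  have hterm : ∀ i, ENNReal.ofReal (w i ^ (2 * (s + 1)) * ‖⟪e i, f⟫_𝕜‖ ^ 2) ≤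
      ENNReal.ofReal (2 * (1 + |lam|) ^ 2) * ENNReal.ofReal (w i ^ (2 * s) * ‖⟪e i, f⟫_𝕜‖ ^ 2) +
        2 * ENNReal.ofReal (w i ^ (2 * s) * ‖⟪e i, B f⟫_𝕜‖ ^ 2) := by
    intro i
    have hwi : 0 ≤ w i := by rw [hw i]; positivity
    rw [← ENNReal.ofReal_mul (by positivity), ← ENNReal.ofReal_ofNat,
      ← ENNReal.ofReal_mul (by norm_num), ← ENNReal.ofReal_add (by positivity) (by positivity)]
    refine ENNReal.ofReal_le_ofReal ?_
    -- `w_i ⟨e_i,f⟩ = (1 + |d_i|) c`, and `|d_i| |c| ≤ (|λ| ) |c| + |⟨e_i, Bf⟩|`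
    set c := ‖⟪e i, f⟫_𝕜‖ with hc
    set b := ‖⟪e i, B f⟫_𝕜‖ with hb
    have hkey : |d i| * c ≤ |lam| * c + b := by
      have h1 : ((d i : 𝕜) - lam) * ⟪e i, f⟫_𝕜 = -⟪e i, B f⟫_𝕜 := by
        linear_combination heig i
      have h2 : ‖((d i : 𝕜) - lam)‖ * c = b := by
        rw [hc, hb, ← norm_mul, h1, norm_neg]
      have h3 : ‖((d i : 𝕜) - lam)‖ = |d i - lam| := by
        rw [← RCLike.ofReal_sub, RCLike.norm_ofReal]
      rw [h3] at h2
      have h4 : |d i| ≤ |d i - lam| + |lam| := by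
        calc |d i| = |(d i - lam) + lam| := by ring_nf
          _ ≤ |d i - lam| + |lam| := abs_add_le _ _
      nlinarith [abs_nonneg (d i - lam), norm_nonneg (⟪e i, f⟫_𝕜)]
    have hwc : w i * c ≤ (1 + |lam|) * c + b := by rw [hw i]; nlinarith [norm_nonneg (⟪e i, f⟫_𝕜)]
    have hsq : (w i * c) ^ 2 ≤ 2 * ((1 + |lam|) * c) ^ 2 + 2 * b ^ 2 := by
      have h0 : 0 ≤ w i * c := mul_nonneg hwi (norm_nonneg _)
      nlinarith [sq_nonneg ((1 + |lam|) * c - b)]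
    have hpow : w i ^ (2 * (s + 1)) * c ^ 2 = w i ^ (2 * s) * (w i * c) ^ 2 := by ring
    rw [hpow]
    calc w i ^ (2 * s) * (w i * c) ^ 2 ≤ w i ^ (2 * s) * (2 * ((1 + |lam|) * c) ^ 2 + 2 * b ^ 2) :=
          mul_le_mul_of_nonneg_left hsq (pow_nonneg hwi _)
      _ = 2 * (1 + |lam|) ^ 2 * (w i ^ (2 * s) * c ^ 2) + 2 * (w i ^ (2 * s) * b ^ 2) := by ring
  calc sobSum e w (s + 1) f ≤ ∑' i, (ENNReal.ofReal (2 * (1 + |lam|) ^ 2) *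
        ENNReal.ofReal (w i ^ (2 * s) * ‖⟪e i, f⟫_𝕜‖ ^ 2) +
        2 * ENNReal.ofReal (w i ^ (2 * s) * ‖⟪e i, B f⟫_𝕜‖ ^ 2)) := ENNReal.tsum_le_tsum hterm
    _ = ENNReal.ofReal (2 * (1 + |lam|) ^ 2) * sobSum e w s f + 2 * sobSum e w s (B f) := by
        rw [ENNReal.tsum_add, ENNReal.tsum_mul_left, ENNReal.tsum_mul_left]
        rfl

/-- **One step of the bootstrap**: `N_{s+1}(f) ≤ 2((1+|λ|)² + W²‖B‖²L^{2s}) N_s(f)`.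
[cite: ReedSimonIV1978, §XIII.16] -/
theorem sobSum_succ_le_of_eigen (hB0 : ∀ i j, j ∉ nbr i → ⟪e j, B (e i)⟫_𝕜 = 0)
    (hBs : ∀ x y, ⟪B x, y⟫_𝕜 = ⟪x, B y⟫_𝕜) (hsymm : ∀ i j, j ∈ nbr i ↔ i ∈ nbr j) {W : ℕ}
    (hW : ∀ i, (nbr i).card ≤ W) {d : ι → ℝ} (hw : ∀ i, w i = 1 + |d i|) {L : ℝ} (hLnn : 0 ≤ L)
    (hL : ∀ i j, j ∈ nbr i → w i ≤ L * w j) {f : H} {lam : ℝ}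
    (heig : ∀ i, (d i : 𝕜) * ⟪e i, f⟫_𝕜 + ⟪e i, B f⟫_𝕜 = (lam : 𝕜) * ⟪e i, f⟫_𝕜) (s : ℕ) :
    sobSum e w (s + 1) f ≤
      ENNReal.ofReal (2 * ((1 + |lam|) ^ 2 + W ^ 2 * ‖B‖ ^ 2 * L ^ (2 * s))) * sobSum e w s f := by
  have hw0 : ∀ i, 0 ≤ w i := fun i ↦ by rw [hw i]; positivity
  have h1 := sobSum_succ_le_of_eigen_aux hw heig s (B := B)
  have h2 := sobSum_map_le hB0 hBs hsymm hW hw0 hLnn hL s f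
  calc sobSum e w (s + 1) f
      ≤ ENNReal.ofReal (2 * (1 + |lam|) ^ 2) * sobSum e w s f + 2 * sobSum e w s (B f) := h1
    _ ≤ ENNReal.ofReal (2 * (1 + |lam|) ^ 2) * sobSum e w s f +
        2 * (ENNReal.ofReal (W ^ 2 * ‖B‖ ^ 2 * L ^ (2 * s)) * sobSum e w s f) :=
        add_le_add le_rfl (mul_le_mul' le_rfl h2)
    _ = ENNReal.ofReal (2 * ((1 + |lam|) ^ 2 + W ^ 2 * ‖B‖ ^ 2 * L ^ (2 * s))) *
          sobSum e w s f := by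
        rw [← mul_assoc, ← add_mul, ← ENNReal.ofReal_ofNat, ← ENNReal.ofReal_mul (by norm_num),
          ← ENNReal.ofReal_add (by positivity) (by positivity)]
        congr 2
        ring

/-- **The bootstrap** (all orders): for `1 ≤ L`,
`N_s(f) ≤ (2((1+|λ|)² + W²‖B‖²L^{2s}))^s ‖f‖²`; in particular `N_s(f) < ∞` for every `s` —
the coefficients of an eigenvector decay faster than any power of the levels.
[cite: ReedSimonIV1978, §XIII.16] -/
theorem sobSum_le_of_eigen (hB0 : ∀ i j, j ∉ nbr i → ⟪e j, B (e i)⟫_𝕜 = 0)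
    (hBs : ∀ x y, ⟪B x, y⟫_𝕜 = ⟪x, B y⟫_𝕜) (hsymm : ∀ i j, j ∈ nbr i ↔ i ∈ nbr j) {W : ℕ}
    (hW : ∀ i, (nbr i).card ≤ W) {d : ι → ℝ} (hw : ∀ i, w i = 1 + |d i|) {L : ℝ} (hL1 : 1 ≤ L)
    (hL : ∀ i j, j ∈ nbr i → w i ≤ L * w j) {f : H} {lam : ℝ}
    (heig : ∀ i, (d i : 𝕜) * ⟪e i, f⟫_𝕜 + ⟪e i, B f⟫_𝕜 = (lam : 𝕜) * ⟪e i, f⟫_𝕜) (s : ℕ) :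
    sobSum e w s f ≤
      ENNReal.ofReal ((2 * ((1 + |lam|) ^ 2 + W ^ 2 * ‖B‖ ^ 2 * L ^ (2 * s))) ^ s * ‖f‖ ^ 2) := by
  have hLnn : 0 ≤ L := zero_le_one.trans hL1
  -- the constants are monotone in `s`
  set K : ℕ → ℝ := fun s ↦ 2 * ((1 + |lam|) ^ 2 + W ^ 2 * ‖B‖ ^ 2 * L ^ (2 * s)) with hK
  have hK0 : ∀ s, 0 ≤ K s := fun s ↦ by positivity
  have hKmono : ∀ s t, s ≤ t → K s ≤ K t := fun s t hst ↦ by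
    simp only [hK]
    have : L ^ (2 * s) ≤ L ^ (2 * t) := pow_le_pow_right₀ hL1 (by omega)
    nlinarith [sq_nonneg ‖B‖, sq_nonneg (W : ℝ),
      mul_nonneg (mul_nonneg (sq_nonneg (W : ℝ)) (sq_nonneg ‖B‖)) (sub_nonneg.2 this)]
  -- induction: `N_s ≤ K(s-1) ⋯ K(0) ‖f‖² ≤ K(s)^s ‖f‖²`
  have hind : ∀ s, sobSum e w s f ≤ ENNReal.ofReal ((K s) ^ s * ‖f‖ ^ 2) := by
    intro s
    induction s with
    | zero => rw [sobSum_zero, pow_zero, one_mul]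
    | succ s ih =>
      have hstep := sobSum_succ_le_of_eigen hB0 hBs hsymm hW hw hLnn hL heig s
      calc sobSum e w (s + 1) f ≤ ENNReal.ofReal (K s) * sobSum e w s f := hstep
        _ ≤ ENNReal.ofReal (K s) * ENNReal.ofReal ((K s) ^ s * ‖f‖ ^ 2) := mul_le_mul' le_rfl ih
        _ = ENNReal.ofReal ((K s) ^ (s + 1) * ‖f‖ ^ 2) := by
            rw [← ENNReal.ofReal_mul (hK0 s)]; ring_nf
        _ ≤ ENNReal.ofReal ((K (s + 1)) ^ (s + 1) * ‖f‖ ^ 2) := by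
            refine ENNReal.ofReal_le_ofReal (mul_le_mul_of_nonneg_right ?_ (sq_nonneg _))
            exact pow_le_pow_left₀ (hK0 s) (hKmono s (s + 1) (Nat.le_succ s)) _
  exact hind s

/-- **Real-valued form**: the weighted coefficient series is summable with the same bound.
[cite: ReedSimonIV1978, §XIII.16] -/
theorem summable_weighted_of_eigen (hB0 : ∀ i j, j ∉ nbr i → ⟪e j, B (e i)⟫_𝕜 = 0)
    (hBs : ∀ x y, ⟪B x, y⟫_𝕜 = ⟪x, B y⟫_𝕜) (hsymm : ∀ i j, j ∈ nbr i ↔ i ∈ nbr j) {W : ℕ}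
    (hW : ∀ i, (nbr i).card ≤ W) {d : ι → ℝ} (hw : ∀ i, w i = 1 + |d i|) {L : ℝ} (hL1 : 1 ≤ L)
    (hL : ∀ i j, j ∈ nbr i → w i ≤ L * w j) {f : H} {lam : ℝ}
    (heig : ∀ i, (d i : 𝕜) * ⟪e i, f⟫_𝕜 + ⟪e i, B f⟫_𝕜 = (lam : 𝕜) * ⟪e i, f⟫_𝕜) (s : ℕ) :
    Summable (fun i ↦ w i ^ (2 * s) * ‖⟪e i, f⟫_𝕜‖ ^ 2) ∧
      ∑' i, w i ^ (2 * s) * ‖⟪e i, f⟫_𝕜‖ ^ 2 ≤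
        (2 * ((1 + |lam|) ^ 2 + W ^ 2 * ‖B‖ ^ 2 * L ^ (2 * s))) ^ s * ‖f‖ ^ 2 := by
  have hw0 : ∀ i, 0 ≤ w i := fun i ↦ by rw [hw i]; positivity
  have hLnn : 0 ≤ L := zero_le_one.trans hL1
  have hnn : ∀ i, 0 ≤ w i ^ (2 * s) * ‖⟪e i, f⟫_𝕜‖ ^ 2 := fun i ↦
    mul_nonneg (pow_nonneg (hw0 i) _) (sq_nonneg _)
  have hb := sobSum_le_of_eigen hB0 hBs hsymm hW hw hL1 hL heig s
  rw [sobSum] at hb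
  have hne : ∑' i, ENNReal.ofReal (w i ^ (2 * s) * ‖⟪e i, f⟫_𝕜‖ ^ 2) ≠ ∞ :=
    ne_top_of_le_ne_top ENNReal.ofReal_ne_top hb
  have hsum : Summable fun i ↦ w i ^ (2 * s) * ‖⟪e i, f⟫_𝕜‖ ^ 2 := by
    have h := ENNReal.summable_toReal hne
    refine h.congr fun i ↦ ?_
    rw [ENNReal.toReal_ofReal (hnn i)]
  refine ⟨hsum, ?_⟩
  have h2 := ENNReal.toReal_mono ENNReal.ofReal_ne_top hb
  rw [ENNReal.toReal_ofReal (by positivity), ← ENNReal.ofReal_tsum_of_nonneg hnn hsum,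
    ENNReal.toReal_ofReal (tsum_nonneg hnn)] at h2
  exact h2

end Banded

end Literature.Analysis.OperatorTheory
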